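import Summits.CriticalPhenomena.PercolationContinuityZ3.Theorems.PercNearOneGluingNoHeavyLowerTailFrontierDecRowsPinnedEdgeRows
import Summits.CriticalPhenomena.PercolationContinuityZ3.Theorems.PercNearOneGluingNoHeavyLowerTailFrontierDecRowsUnmarkedEdgeKey
import HarnessLib

/-!
# The seven open four-point rows, each for ALL `n` from ONE cubic KEY inequality at ONE terminal type
# (bnk-1's KEY reduction ∘ the pinned-terminal schema)

Support file (prover seat `prim-l12-p6`, gen 4; `--supports stmt-CriticalPhenomena-4575`).  No definitions, no named facts, no sorries, no `native_decide`.
Composition of `…FrontierDecRowsUnmarkedEdgeKey` (prim-bnk-1 gen 9: `KeyHypAt i₀` — `K = 3B₁ − 2B₀ ≥ 0` at the edges from the terminal `i₀` to an unmarked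
vertex, given the induction-hypothesis rows — implies `UnmarkedEdgeHypAt i₀` for decreasing families, `unmarkedEdgeHypAt_row_of_keyHypAt`) with
`…FrontierDecRowsPinnedEdgeRows` (this seat: a row with a singleton side `{x i₀}` holds for all `n` from the hypotheses at THAT terminal alone).
NET STATEMENTS (`K` = one cubic form in the 52-cell five-point law under `w[e↦0]`, census-clean in every cell of ttrl cp-hms BERNSTEIN-PIECES §831 and
bnk-1 g9's K-census):
* `frontier_36_all_of_keyAt (i₀ : Fin 4)`: PATH on every finite weighted graph ⟸ `∀ m, KeyHypAt i₀ (PATH families on Fin m)` for ANY ONE `i₀`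
  (bnk-1's `frontier_36_all_of_key0_key2` needed `i₀ = 0` AND `i₀ = 2`);
* `frontier_44_all_of_keyAt (i₀ : Fin 4)` (bnk-1: `frontier_44_all_of_key0`);
* `frontier_12_of_keyAt` (`i₀ ∈ {1,2,3}`), `frontier_15_of_keyAt` (`{1,2,3}`), `frontier_27_of_keyAt` (`{2,3}`), `frontier_30_of_keyAt` (`{1,2}`),
  `frontier_37_of_keyAt` (`{1,2,3}`) — pairwise distinct terminals.
So e.g. ROW 30 FOR ALL GRAPHS ⟸ `K ≥ 0` at the edges `b — u` (`u` unmarked), the census' roomiest open form (`min B₁/(B₀+B₃) = 0.277`, no exact zeros).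
-/

noncomputable section

namespace Summit.CriticalPhenomena.PercolationContinuityZ3.Theorems

namespace TerminalEdgeInduction

open MeasureTheory Literature.Probability.Percolation Literature.Probability.LatticeModels
open EdgeInduction CovTransferCert E3GroupSepCert
open scoped Classical

variable {n : ℕ}

/-- **PATH `(D[a|b], D[a|c], D[b|y])`, ALL markings, KEY forms at ANY ONE terminal (bnk-1: hub AND leaf).** [this work] -/
theorem frontier_36_all_of_keyAt (i₀ : Fin 4)
    (h : ∀ m : ℕ, KeyHypAt i₀ (fun x : Fin 4 → Fin m => connEvent (FrontierDecRows.row 36 m (x 0, x 1, x 2, x 3)).1)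
      (fun x => connEvent (FrontierDecRows.row 36 m (x 0, x 1, x 2, x 3)).2.1)
      (fun x => connEvent (FrontierDecRows.row 36 m (x 0, x 1, x 2, x 3)).2.2))
    (w : Sym2 (Fin n) → unitInterval) (a b c y : Fin n) :
    0 ≤ sahiE3 (prodBernoulli w) (connEvent (FrontierDecRows.row 36 n (a, b, c, y)).1)
      (connEvent (FrontierDecRows.row 36 n (a, b, c, y)).2.1) (connEvent (FrontierDecRows.row 36 n (a, b, c, y)).2.2) :=
  frontier_36_all_of_at i₀ (fun m => unmarkedEdgeHypAt_row_of_keyHypAt 36 i₀ (h m)) w a b c y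

/-- **row 44 `(D[ab|cy], D[a|b], D[c|y])`, all markings, any one terminal.** [this work] -/
theorem frontier_44_all_of_keyAt (i₀ : Fin 4)
    (h : ∀ m : ℕ, KeyHypAt i₀ (fun x : Fin 4 → Fin m => connEvent (FrontierDecRows.row 44 m (x 0, x 1, x 2, x 3)).1)
      (fun x => connEvent (FrontierDecRows.row 44 m (x 0, x 1, x 2, x 3)).2.1)
      (fun x => connEvent (FrontierDecRows.row 44 m (x 0, x 1, x 2, x 3)).2.2))
    (w : Sym2 (Fin n) → unitInterval) (a b c y : Fin n) :
    0 ≤ sahiE3 (prodBernoulli w) (connEvent (FrontierDecRows.row 44 n (a, b, c, y)).1)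
      (connEvent (FrontierDecRows.row 44 n (a, b, c, y)).2.1) (connEvent (FrontierDecRows.row 44 n (a, b, c, y)).2.2) :=
  frontier_44_all_of_at i₀ (fun m => unmarkedEdgeHypAt_row_of_keyHypAt 44 i₀ (h m)) w a b c y

/-- **row 12 `(D[ab|c], D[ac|by], D[b|y])`, pairwise distinct terminals, `i₀ ∈ {b,c,y}` — census pick: `b`.** [this work] -/
theorem frontier_12_of_keyAt (i₀ : Fin 4) (hi₀ : i₀ = 1 ∨ i₀ = 2 ∨ i₀ = 3)
    (h : ∀ m : ℕ, KeyHypAt i₀ (fun x : Fin 4 → Fin m => connEvent (FrontierDecRows.row 12 m (x 0, x 1, x 2, x 3)).1)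
      (fun x => connEvent (FrontierDecRows.row 12 m (x 0, x 1, x 2, x 3)).2.1)
      (fun x => connEvent (FrontierDecRows.row 12 m (x 0, x 1, x 2, x 3)).2.2))
    (w : Sym2 (Fin n) → unitInterval) (a b c y : Fin n) (hab : a ≠ b) (hac : a ≠ c) (hay : a ≠ y) (hbc : b ≠ c)
    (hby : b ≠ y) (hcy : c ≠ y) :
    0 ≤ sahiE3 (prodBernoulli w) (connEvent (FrontierDecRows.row 12 n (a, b, c, y)).1)
      (connEvent (FrontierDecRows.row 12 n (a, b, c, y)).2.1) (connEvent (FrontierDecRows.row 12 n (a, b, c, y)).2.2) :=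
  frontier_12_of_at i₀ hi₀ (fun m => unmarkedEdgeHypAt_row_of_keyHypAt 12 i₀ (h m)) w a b c y hab hac hay hbc hby hcy

/-- **row 15 `(D[ab|c], D[ac|y], D[b|y])`, pairwise distinct terminals, `i₀ ∈ {b,c,y}` — census pick: `y`.** [this work] -/
theorem frontier_15_of_keyAt (i₀ : Fin 4) (hi₀ : i₀ = 1 ∨ i₀ = 2 ∨ i₀ = 3)
    (h : ∀ m : ℕ, KeyHypAt i₀ (fun x : Fin 4 → Fin m => connEvent (FrontierDecRows.row 15 m (x 0, x 1, x 2, x 3)).1)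
      (fun x => connEvent (FrontierDecRows.row 15 m (x 0, x 1, x 2, x 3)).2.1)
      (fun x => connEvent (FrontierDecRows.row 15 m (x 0, x 1, x 2, x 3)).2.2))
    (w : Sym2 (Fin n) → unitInterval) (a b c y : Fin n) (hab : a ≠ b) (hac : a ≠ c) (hay : a ≠ y) (hbc : b ≠ c)
    (hby : b ≠ y) (hcy : c ≠ y) :
    0 ≤ sahiE3 (prodBernoulli w) (connEvent (FrontierDecRows.row 15 n (a, b, c, y)).1)
      (connEvent (FrontierDecRows.row 15 n (a, b, c, y)).2.1) (connEvent (FrontierDecRows.row 15 n (a, b, c, y)).2.2) :=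
  frontier_15_of_at i₀ hi₀ (fun m => unmarkedEdgeHypAt_row_of_keyHypAt 15 i₀ (h m)) w a b c y hab hac hay hbc hby hcy

/-- **row 27 `(D[ab|c], D[ab|y], D[ac|by])`, pairwise distinct terminals, `i₀ ∈ {c,y}`.** [this work] -/
theorem frontier_27_of_keyAt (i₀ : Fin 4) (hi₀ : i₀ = 2 ∨ i₀ = 3)
    (h : ∀ m : ℕ, KeyHypAt i₀ (fun x : Fin 4 → Fin m => connEvent (FrontierDecRows.row 27 m (x 0, x 1, x 2, x 3)).1)
      (fun x => connEvent (FrontierDecRows.row 27 m (x 0, x 1, x 2, x 3)).2.1)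
      (fun x => connEvent (FrontierDecRows.row 27 m (x 0, x 1, x 2, x 3)).2.2))
    (w : Sym2 (Fin n) → unitInterval) (a b c y : Fin n) (hab : a ≠ b) (hac : a ≠ c) (hay : a ≠ y) (hbc : b ≠ c)
    (hby : b ≠ y) (hcy : c ≠ y) :
    0 ≤ sahiE3 (prodBernoulli w) (connEvent (FrontierDecRows.row 27 n (a, b, c, y)).1)
      (connEvent (FrontierDecRows.row 27 n (a, b, c, y)).2.1) (connEvent (FrontierDecRows.row 27 n (a, b, c, y)).2.2) :=
  frontier_27_of_at i₀ hi₀ (fun m => unmarkedEdgeHypAt_row_of_keyHypAt 27 i₀ (h m)) w a b c y hab hac hay hbc hby hcy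

/-- **row 30 `(D[ab|c], D[ac|by], D[b|cy])`, pairwise distinct terminals, `i₀ ∈ {b,c}` — roomiest open case.** [this work] -/
theorem frontier_30_of_keyAt (i₀ : Fin 4) (hi₀ : i₀ = 1 ∨ i₀ = 2)
    (h : ∀ m : ℕ, KeyHypAt i₀ (fun x : Fin 4 → Fin m => connEvent (FrontierDecRows.row 30 m (x 0, x 1, x 2, x 3)).1)
      (fun x => connEvent (FrontierDecRows.row 30 m (x 0, x 1, x 2, x 3)).2.1)
      (fun x => connEvent (FrontierDecRows.row 30 m (x 0, x 1, x 2, x 3)).2.2))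
    (w : Sym2 (Fin n) → unitInterval) (a b c y : Fin n) (hab : a ≠ b) (hac : a ≠ c) (hay : a ≠ y) (hbc : b ≠ c)
    (hby : b ≠ y) (hcy : c ≠ y) :
    0 ≤ sahiE3 (prodBernoulli w) (connEvent (FrontierDecRows.row 30 n (a, b, c, y)).1)
      (connEvent (FrontierDecRows.row 30 n (a, b, c, y)).2.1) (connEvent (FrontierDecRows.row 30 n (a, b, c, y)).2.2) :=
  frontier_30_of_at i₀ hi₀ (fun m => unmarkedEdgeHypAt_row_of_keyHypAt 30 i₀ (h m)) w a b c y hab hac hay hbc hby hcy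

/-- **row 37 `(D[ab|c], D[ac|y], D[ay|b])`, pairwise distinct terminals, `i₀ ∈ {b,c,y}` — census pick: `b`.** [this work] -/
theorem frontier_37_of_keyAt (i₀ : Fin 4) (hi₀ : i₀ = 1 ∨ i₀ = 2 ∨ i₀ = 3)
    (h : ∀ m : ℕ, KeyHypAt i₀ (fun x : Fin 4 → Fin m => connEvent (FrontierDecRows.row 37 m (x 0, x 1, x 2, x 3)).1)
      (fun x => connEvent (FrontierDecRows.row 37 m (x 0, x 1, x 2, x 3)).2.1)
      (fun x => connEvent (FrontierDecRows.row 37 m (x 0, x 1, x 2, x 3)).2.2))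
    (w : Sym2 (Fin n) → unitInterval) (a b c y : Fin n) (hab : a ≠ b) (hac : a ≠ c) (hay : a ≠ y) (hbc : b ≠ c)
    (hby : b ≠ y) (hcy : c ≠ y) :
    0 ≤ sahiE3 (prodBernoulli w) (connEvent (FrontierDecRows.row 37 n (a, b, c, y)).1)
      (connEvent (FrontierDecRows.row 37 n (a, b, c, y)).2.1) (connEvent (FrontierDecRows.row 37 n (a, b, c, y)).2.2) :=
  frontier_37_of_at i₀ hi₀ (fun m => unmarkedEdgeHypAt_row_of_keyHypAt 37 i₀ (h m)) w a b c y hab hac hay hbc hby hcy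

end TerminalEdgeInduction

end Summit.CriticalPhenomena.PercolationContinuityZ3.Theorems
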